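import Mathlib
import HarnessLib

/-!
# [OURS · L1 W4.5(b) · EL♮(3) · door ν4, HSUBᵉ brick N-0 (JINIT), algebra layer] THE HYPERPLANE SUBSTITUTION `x_a ↦ Σ_j B_{aj} X_j`:
# a homogeneous SECTION, the KERNEL `(ℓ_B)`, and the transfer of `ϖ`-saturation and radicality to `(ℓ_B, Ĝ)`

res-L1-w45b-nose-w1 g3 (WIDTH seat D-0157 DOOR 1; HSUBᵉ pen, brick N-0 = `jinit_rPlus` of ✓ `Equinodal.hsube_of_suppliers`).  OURS; NOT a
statement of any manuscript; AI-written, weaker than expert review.  No `sorry`; standard axioms; DEF-FREE; pure polynomial algebra over a commutative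
ring.  `--kind proof --supports stmt-ResolutionOfSingularities-20148 --as helper`.  EL♮(3) is NOT proved; resolution in char p is NOT proved anywhere here.

WHAT.  `B : Fin (n+1) → Fin n → R` with an invertible `n × n` row-minor `M = (B_{r j, j'})` (rows `r : Fin n ↪ Fin (n+1)`, complementary index `a₀`),
`ψ_B = aeval (x_a ↦ Σ_j B_{aj} X_j) : R[x₀..xₙ] → R[X₀..X_{n−1}]` (= `restrictToHyperplane B` of …NatResidueHypDefsE over a field):
* ★ `exists_hyperplane_section` — there are a LINEAR form `L` with `coeff x_{a₀} L = 1`, `ψ L = 0`, and a substitution `τ_i = Σ_j N_{ij} x_{r j}`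
  (`N = M⁻¹`) with `ψ (G(τ)) = G` for every `G`, such that `ψ f = 0 ⇒ L ∣ f` (so `ker ψ = (L)`);
* `span_pair_eq_comap` — `(L, G(τ)) = ψ⁻¹ (G)`; hence `saturated_pair_of_saturated` (`C ϖ · y ∈ (L, G(τ)) ⇒ y ∈ (L, G(τ))` from the same
  for `(G)`, the input of ✓ `SatLift.flat_subschemeι_projIdealSheaf_of_saturated` with ✓ `Equinodal.mem_span_of_uniformizer_mul_mem`) and
  `isRadical_pair_of_isRadical` (`(G)` radical ⇒ `(L, G(τ))` radical, the input of ✓ `SatLift.projIdealSheaf_span_eq_vanishingIdeal`).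
USE (N-0): upstairs nose model `𝓦₀ = (ℓ̃_B, Ĝ)~ ⊂ ℙ³_O` with `Ĝ = G(τ)` for the ternary equinodal lift `G` of ✓ `Equinodal.exists_equinodal_lift_of_cert`:
`O`-flat (saturation) with REDUCED trace (radicality downstairs from `Squarefree`). [folklore; elementary]
-/

set_option linter.dupNamespace false -- mandated namespace `Summit.<Summit>.<Problem>` of this single-conjunct summit

noncomputable section

open MvPolynomial

namespace Summit.ResolutionOfSingularities.ResolutionOfSingularities.Cruxes.EquisingularLiftNat.Sections.Equinodal

namespace HyperplaneAlg

variable {R : Type*} [CommRing R] {n : ℕ}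

/-- Two `R`-algebra maps out of a polynomial ring agree modulo the ideal generated by the differences of their values on the variables:
`f − ρ f ∈ (x_a − ρ x_a)_a`. [folklore] -/
theorem sub_algHom_mem_span (ρ : MvPolynomial (Fin (n + 1)) R →ₐ[R] MvPolynomial (Fin (n + 1)) R) (f : MvPolynomial (Fin (n + 1)) R) :
    f - ρ f ∈ Ideal.span (Set.range fun a : Fin (n + 1) => X a - ρ (X a)) := by
  set I : Ideal (MvPolynomial (Fin (n + 1)) R) := Ideal.span (Set.range fun a : Fin (n + 1) => X a - ρ (X a)) with hI
  rw [← Ideal.Quotient.eq]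
  have h : (Ideal.Quotient.mkₐ R I).comp (AlgHom.id R _) = (Ideal.Quotient.mkₐ R I).comp ρ := by
    refine MvPolynomial.algHom_ext fun a => ?_
    simp only [AlgHom.comp_apply, AlgHom.id_apply, Ideal.Quotient.mkₐ_eq_mk]
    rw [Ideal.Quotient.eq]
    exact Ideal.subset_span ⟨a, rfl⟩
  have h2 := congrArg (fun g => g f) h
  simpa only [AlgHom.comp_apply, AlgHom.id_apply, Ideal.Quotient.mkₐ_eq_mk] using h2

/-- A substitution of variables by LINEAR forms preserves homogeneity of each degree. [folklore] -/
theorem isHomogeneous_aeval_linear {σ τ : Type*} (f : σ → MvPolynomial τ R) (hf : ∀ a, (f a).IsHomogeneous 1)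
    (g : MvPolynomial σ R) {e : ℕ} (hg : g.IsHomogeneous e) : (aeval f g).IsHomogeneous e := by
  simpa using hg.aeval f (n := 1) hf

/-- the linear forms `Σ_j c_j X_{r j}` are homogeneous of degree one. [folklore] -/
theorem isHomogeneous_sum_C_mul_X {ι τ : Type*} [Fintype ι] (c : ι → R) (v : ι → τ) :
    (∑ j, C (c j) * X (v j) : MvPolynomial τ R).IsHomogeneous 1 :=
  IsHomogeneous.sum _ _ _ fun j _ => (isHomogeneous_X R (v j)).C_mul (c j)

/-- `Fin (n+1) = {a₀} ⊔ range r` for an injective `r : Fin n → Fin (n+1)` missing `a₀`. [folklore] -/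
theorem eq_or_exists_eq (r : Fin n → Fin (n + 1)) (a₀ : Fin (n + 1)) (hr : Function.Injective r) (ha₀ : ∀ j, r j ≠ a₀)
    (a : Fin (n + 1)) : a = a₀ ∨ ∃ j, a = r j := by
  classical
  let φ : Option (Fin n) → Fin (n + 1) := fun o => o.elim a₀ r
  have hφ : Function.Injective φ := by
    rintro (_ | j) (_ | j') h
    · rfl
    · exact absurd h.symm (ha₀ j')
    · exact absurd h (ha₀ j)
    · simp only [φ, Option.elim] at h; rw [hr h]
  have hsurj : Function.Surjective φ :=
    ((Fintype.bijective_iff_injective_and_card φ).mpr ⟨hφ, by simp⟩).2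
  obtain ⟨o, ho⟩ := hsurj a
  rcases o with _ | j
  · exact Or.inl ho.symm
  · exact Or.inr ⟨j, ho.symm⟩

/-- linear substitution applied to a linear form `Σ_j c_j X_{v j}`: `aeval f (Σ c_j X_{v j}) = Σ c_j f (v j)`. [folklore] -/
theorem aeval_sum_C_mul_X {ι σ τ : Type*} [Fintype ι] (f : σ → MvPolynomial τ R) (c : ι → R) (v : ι → σ) :
    aeval f (∑ j, C (c j) * X (v j) : MvPolynomial σ R) = ∑ j, C (c j) * f (v j) := by
  simp only [map_sum, map_mul, aeval_C, aeval_X, algebraMap_eq]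

/-- the coefficient of `x_{a₀}` in a linear form supported on variables `≠ a₀` vanishes. [folklore] -/
theorem coeff_single_sum_C_mul_X_of_ne {ι σ : Type*} [Fintype ι] (c : ι → R) (v : ι → σ) (a₀ : σ) (hv : ∀ j, v j ≠ a₀) :
    coeff (Finsupp.single a₀ 1) (∑ j, C (c j) * X (v j) : MvPolynomial σ R) = 0 := by
  classical
  rw [coeff_sum]
  refine Finset.sum_eq_zero fun j _ => ?_
  rw [coeff_C_mul, coeff_X, if_neg, mul_zero]
  exact fun h => hv j (Finsupp.single_left_injective one_ne_zero h)

/-- ★ **THE HYPERPLANE SUBSTITUTION HAS A HOMOGENEOUS SECTION AND KERNEL `(L)`, `L` LINEAR WITH `coeff x_{a₀} L = 1`.**  For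
`B : Fin (n+1) → Fin n → R` whose row-minor on `r : Fin n → Fin (n+1)` (injective, missing `a₀`) has unit determinant, with
`ψ = aeval (x_a ↦ Σ_j B_{aj} X_j)`: there are `L` and `N` with `L` homogeneous of degree `1`, `coeff x_{a₀} L = 1`, `ψ L = 0`,
`ψ (G(τ)) = G` for `τ_i = Σ_j N_{ij} x_{r j}` and every `G`, and `ψ f = 0 ⇒ L ∣ f`. [folklore; linear algebra] -/
theorem exists_hyperplane_section (B : Fin (n + 1) → Fin n → R) (r : Fin n → Fin (n + 1)) (a₀ : Fin (n + 1))
    (hr : Function.Injective r) (ha₀ : ∀ j, r j ≠ a₀)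
    (hM : IsUnit (Matrix.of fun j j' : Fin n => B (r j) j').det) :
    ∃ (L : MvPolynomial (Fin (n + 1)) R) (N : Fin n → Fin n → R),
      L.IsHomogeneous 1 ∧ coeff (Finsupp.single a₀ 1) L = 1 ∧
      aeval (fun a : Fin (n + 1) => ∑ j : Fin n, C (B a j) * X j) L = 0 ∧
      (∀ G : MvPolynomial (Fin n) R,
        aeval (fun a : Fin (n + 1) => ∑ j : Fin n, C (B a j) * X j)
          (aeval (fun i : Fin n => ∑ j : Fin n, C (N i j) * X (r j)) G) = G) ∧
      (∀ f : MvPolynomial (Fin (n + 1)) R, aeval (fun a : Fin (n + 1) => ∑ j : Fin n, C (B a j) * X j) f = 0 → L ∣ f) := by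
  classical
  set M : Matrix (Fin n) (Fin n) R := Matrix.of fun j j' : Fin n => B (r j) j' with hMdef
  set N : Matrix (Fin n) (Fin n) R := M⁻¹ with hNdef
  set ψ : MvPolynomial (Fin (n + 1)) R →ₐ[R] MvPolynomial (Fin n) R :=
    aeval (fun a : Fin (n + 1) => ∑ j : Fin n, C (B a j) * X j) with hψ
  set σ : MvPolynomial (Fin n) R →ₐ[R] MvPolynomial (Fin (n + 1)) R :=
    aeval (fun i : Fin n => ∑ j : Fin n, C (N i j) * X (r j)) with hσ
  -- the two matrix identities, entrywise
  have hNM : ∀ i j' : Fin n, (∑ j, N i j * B (r j) j') = if i = j' then 1 else 0 := by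
    intro i j'
    have h := congrArg (fun A : Matrix (Fin n) (Fin n) R => A i j') (Matrix.nonsing_inv_mul M hM)
    simpa [Matrix.mul_apply, Matrix.one_apply, hMdef] using h
  have hMN : ∀ j j'' : Fin n, (∑ j', B (r j) j' * N j' j'') = if j = j'' then 1 else 0 := by
    intro j j''
    have h := congrArg (fun A : Matrix (Fin n) (Fin n) R => A j j'') (Matrix.mul_nonsing_inv M hM)
    simpa [Matrix.mul_apply, Matrix.one_apply, hMdef] using h
  -- `ψ ∘ σ = id` on variables
  have hψσX : ∀ i : Fin n, ψ (σ (X i)) = X i := by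
    intro i
    rw [hσ, aeval_X, hψ, aeval_sum_C_mul_X]
    simp_rw [Finset.mul_sum, ← mul_assoc, ← C_mul]
    rw [Finset.sum_comm]
    simp_rw [← Finset.sum_mul, ← map_sum, hNM]
    simp
  have hψσ : ∀ G : MvPolynomial (Fin n) R, ψ (σ G) = G := by
    intro G
    have h : ψ.comp σ = AlgHom.id R _ := MvPolynomial.algHom_ext fun i => by simpa using hψσX i
    simpa using congrArg (fun g => g G) h
  -- `σ ∘ ψ = id` on the variables `x_{r j}`
  have hσψX : ∀ j : Fin n, σ (ψ (X (r j))) = X (r j) := by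
    intro j
    rw [hψ, aeval_X, hσ, aeval_sum_C_mul_X]
    simp_rw [Finset.mul_sum, ← mul_assoc, ← C_mul]
    rw [Finset.sum_comm]
    simp_rw [← Finset.sum_mul, ← map_sum]
    have : ∀ x : Fin n, (∑ i, B (r j) i * N i x) = if j = x then 1 else 0 := fun x => hMN j x
    simp_rw [this]
    simp [Finset.sum_ite_eq]
  -- the linear form
  refine ⟨X a₀ - σ (ψ (X a₀)), fun i j => N i j, ?_, ?_, ?_, hψσ, ?_⟩
  · -- homogeneous of degree one
    refine (isHomogeneous_X R a₀).sub ?_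
    rw [hψ, aeval_X, hσ, aeval_sum_C_mul_X]
    exact IsHomogeneous.sum _ _ _ fun j _ => (isHomogeneous_sum_C_mul_X _ _).C_mul _
  · -- the coefficient of `x_{a₀}`
    rw [coeff_sub, coeff_X, if_pos rfl, hψ, aeval_X, hσ, aeval_sum_C_mul_X, coeff_sum, sub_eq_self]
    refine Finset.sum_eq_zero fun j _ => ?_
    rw [coeff_C_mul, coeff_single_sum_C_mul_X_of_ne _ _ _ ha₀, mul_zero]
  · -- `ψ L = 0`
    rw [map_sub, hψσ, sub_self]
  · -- the kernel
    intro f hf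
    have hmem := sub_algHom_mem_span (σ.comp ψ) f
    have hρ : (σ.comp ψ) f = 0 := by rw [AlgHom.comp_apply, hf, map_zero]
    rw [hρ, sub_zero] at hmem
    -- the generators `x_a − σ ψ x_a` are `0` (a = r j) or `L` (a = a₀)
    rw [← Ideal.mem_span_singleton]
    refine (Ideal.span_le.mpr ?_) hmem
    rintro _ ⟨a, rfl⟩
    rcases eq_or_exists_eq r a₀ hr ha₀ a with rfl | ⟨j, rfl⟩
    · exact Ideal.subset_span (by simp [AlgHom.comp_apply])
    · simp only [AlgHom.comp_apply, hσψX, sub_self, SetLike.mem_coe, Ideal.zero_mem]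

/-! ## Transfer along a retraction with principal kernel (generic: `ψ : A → B` a ring map, `σ` a set-theoretic section, `ker ψ = (L)`) -/

section Transfer

variable {A B : Type*} [CommRing A] [CommRing B] (ψ : A →+* B) (σ : B → A) (L : A)

/-- `(L, σ G) = ψ⁻¹ (G)` when `ψ L = 0`, `ψ ∘ σ = id` and `ker ψ ⊆ (L)`. [folklore] -/
theorem span_pair_eq_comap (hL : ψ L = 0) (hψσ : ∀ G, ψ (σ G) = G) (hker : ∀ f, ψ f = 0 → L ∣ f) (G : B) :
    Ideal.span {L, σ G} = (Ideal.span {G}).comap ψ := by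
  apply le_antisymm
  · rw [Ideal.span_le]
    rintro x (rfl | rfl)
    · simp [hL]
    · simp [hψσ]
  · intro y hy
    rw [Ideal.mem_comap, Ideal.mem_span_singleton'] at hy
    obtain ⟨h, hh⟩ := hy
    have hk : ψ (y - σ h * σ G) = 0 := by rw [map_sub, map_mul, hψσ, hψσ, hh, sub_self]
    obtain ⟨m, hm⟩ := hker _ hk
    have : y = m * L + σ h * σ G := by rw [mul_comm m L, ← hm]; ring
    rw [this]
    exact Ideal.add_mem _ (Ideal.mul_mem_left _ _ (Ideal.subset_span (by simp)))
      (Ideal.mul_mem_left _ _ (Ideal.subset_span (by simp)))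

/-- `c`-SATURATION transfers: if `(G)` is `ψ c`-saturated then `(L, σ G)` is `c`-saturated. [folklore] -/
theorem saturated_pair_of_saturated (hL : ψ L = 0) (hψσ : ∀ G, ψ (σ G) = G) (hker : ∀ f, ψ f = 0 → L ∣ f) (G : B)
    (c : A) (hsat : ∀ y : B, ψ c * y ∈ Ideal.span {G} → y ∈ Ideal.span {G}) :
    ∀ y : A, c * y ∈ Ideal.span {L, σ G} → y ∈ Ideal.span {L, σ G} := by
  intro y hy
  rw [span_pair_eq_comap ψ σ L hL hψσ hker G, Ideal.mem_comap] at hy ⊢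
  rw [map_mul] at hy
  exact hsat _ hy

/-- RADICALITY transfers: if `(G)` is radical then `(L, σ G)` is radical. [folklore] -/
theorem isRadical_pair_of_isRadical (hL : ψ L = 0) (hψσ : ∀ G, ψ (σ G) = G) (hker : ∀ f, ψ f = 0 → L ∣ f) (G : B)
    (hrad : (Ideal.span {G}).IsRadical) : (Ideal.span {L, σ G}).IsRadical := by
  rw [span_pair_eq_comap ψ σ L hL hψσ hker G]
  intro x hx
  obtain ⟨m, hm⟩ := hx
  rw [Ideal.mem_comap, map_pow] at hm
  exact hrad ⟨m, hm⟩

/-- every element is congruent to the section of its image modulo `L`: `L ∣ f − σ (ψ f)`. [folklore] -/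
theorem dvd_sub_section (hψσ : ∀ G, ψ (σ G) = G) (hker : ∀ f, ψ f = 0 → L ∣ f) (f : A) : L ∣ f - σ (ψ f) :=
  hker _ (by rw [map_sub, hψσ, sub_self])

end Transfer

/-- a SQUAREFREE polynomial over a field generates a RADICAL ideal (unique factorisation). [folklore] -/
theorem isRadical_span_singleton_of_squarefree {k : Type*} [Field k] {σ' : Type*} (G : MvPolynomial σ' k) (hG : Squarefree G) :
    (Ideal.span {G}).IsRadical :=
  (isRadical_iff_span_singleton).mp hG.isRadical

end HyperplaneAlg

end Summit.ResolutionOfSingularities.ResolutionOfSingularities.Cruxes.EquisingularLiftNat.Sections.Equinodal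

end
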